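/-
Copyright (c) 2026. All rights reserved.
Released under Apache 2.0 license as described in the file LICENSE.
Authors: abc-iut cell, statement-typer seat abc-iut-L4-t9 (wave 2, block W2-B2).
-/
import Literature.AnabelianGeometry.AbsoluteAnabelian.AbsTopIII.BiAnabelianDiagrams

/-!
# [AbsTopIII] Corollary 3.7 (i), second half — PROOF: the second factor `𝒳` forms a core of `𝒟‡_{≤1}`

S. Mochizuki, *Topics in absolute anabelian geometry III* [MochizukiAbsTopIII2015], Cor 3.7 (i) p. 87
(manuscript `paper:url-5493eb38cbb7`): "`𝒟‡_{≤1}` admits a natural structure of core on `𝒟†_{≤1}`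
[...] the 'second factor' `𝒳` 'forms a core' of the functors in `𝒟‡_{≤1}`."

Proof-only companion of `BiAnabelianDiagrams.lean` (no new statements): we DISCHARGE
`BiAnabelianSetting.RefCoreStmt` for EVERY setting `𝔖`. Since the row-1 functor
`log_𝒳 = log ×_𝔈 𝒳` acts on the first factor only, every path functor of `𝒟‡_{≤1}` followed by the
canonical functor to the core vertex (`π` on row 1, the identity at the core) EQUALS that canonical
functor (`pathFunctor_comp_toRef`); hence all path functors into the core vertex coincide and the
family of identity homotopies (`eqToHom`) on all co-verticial pairs ending at the core vertex is a
core structure (`refCoreFamily`, `refCoreStmt_holds`). Nothing here bears on [IUTchIII] Cor. 3.12.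
-/

set_option autoImplicit false

namespace Literature.AnabelianGeometry.AbsoluteAnabelian.AbsTopIII

open CategoryTheory Quiver DiagramOfCategories

universe u

namespace BiAnabelianSetting

variable {X E N : Type u} [Category.{u} X] [Category.{u} E] [Category.{u} N]
  (𝔖 : BiAnabelianSetting X E N)

/-- The diagram of categories `𝒟‡_{≤1}` (row 1 of `𝒟†` extended by the core vertex `𝒳` and the
projections `π_⋎`). [cite: MochizukiAbsTopIII2015, Cor 3.7 (i) p.87] -/
abbrev refDiagram : DiagramOfCategories refCoreShape.{u}.Vertex := (𝔖.daggerLe 1).extend 𝔖.refCoreExt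

/-- The canonical functor from the category at a vertex of `𝒟‡_{≤1}` to the core category `𝒳`:
`π` on the first row, the identity at the core vertex (the other vertices do not belong to
`𝒟†_{≤1}`). [cite: MochizukiAbsTopIII2015, Cor 3.7 (i) p.87] -/
def toRef : ∀ a : refCoreShape.{u}.Vertex, 𝔖.refDiagram.obj a ⥤ X
  | ExtVertex.obs => 𝟭 X
  | ExtVertex.base ⟨.first _, _⟩ => 𝔖.proj
  | ExtVertex.base ⟨.box, h⟩ => False.elim (by simpa [Cor37Vertex.row] using h.2)
  | ExtVertex.base ⟨.space, h⟩ => False.elim (by simpa [Cor37Vertex.row] using h.2)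
  | ExtVertex.base ⟨.galois, h⟩ => False.elim (by simpa [Cor37Vertex.row] using h.2)
  | ExtVertex.base ⟨.ref, h⟩ => False.elim (h.1 rfl)

/-- Each edge functor of `𝒟‡_{≤1}` commutes on the nose with the canonical functors to the core:
`log_𝒳 ⋙ π = π` (`FiberSquare.baseChange_comp_π₂`) and `π_⋎ ⋙ id = π`.
[cite: MochizukiAbsTopIII2015, Cor 3.7 (i) p.87] -/
theorem map_comp_toRef : ∀ {a b : refCoreShape.{u}.Vertex} (e : a ⟶ b),
    𝔖.refDiagram.map e ⋙ 𝔖.toRef b = 𝔖.toRef a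
  | ExtVertex.base ⟨.first _, _⟩, ExtVertex.base ⟨.first _, _⟩, (Cor37Edge.log _ _ _) => rfl
  | ExtVertex.base ⟨.first _, _⟩, ExtVertex.obs, _ => rfl
  | ExtVertex.base ⟨.box, h⟩, _, _ => False.elim (by simpa [Cor37Vertex.row] using h.2)
  | ExtVertex.base ⟨.space, h⟩, _, _ => False.elim (by simpa [Cor37Vertex.row] using h.2)
  | ExtVertex.base ⟨.galois, h⟩, _, _ => False.elim (by simpa [Cor37Vertex.row] using h.2)
  | ExtVertex.base ⟨.ref, h⟩, _, _ => False.elim (h.1 rfl)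
  | _, ExtVertex.base ⟨.box, h⟩, _ => False.elim (by simpa [Cor37Vertex.row] using h.2)
  | _, ExtVertex.base ⟨.space, h⟩, _ => False.elim (by simpa [Cor37Vertex.row] using h.2)
  | _, ExtVertex.base ⟨.galois, h⟩, _ => False.elim (by simpa [Cor37Vertex.row] using h.2)
  | _, ExtVertex.base ⟨.ref, h⟩, _ => False.elim (h.1 rfl)
  | ExtVertex.obs, ExtVertex.obs, e => PEmpty.elim e
  | ExtVertex.obs, ExtVertex.base ⟨.first _, _⟩, e => PEmpty.elim e

/-- Every path functor of `𝒟‡_{≤1}` followed by the canonical functor to the core equals the canonical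
functor at its source. [cite: MochizukiAbsTopIII2015, Cor 3.7 (i) p.87] -/
theorem pathFunctor_comp_toRef {a b : refCoreShape.{u}.Vertex} (p : Path a b) :
    𝔖.refDiagram.pathFunctor p ⋙ 𝔖.toRef b = 𝔖.toRef a := by
  induction p with
  | nil => rw [pathFunctor_nil]; rfl
  | cons p e ih => rw [pathFunctor_cons, Functor.assoc, map_comp_toRef, ih]

/-- All path functors of `𝒟‡_{≤1}` into the core vertex coincide (they all equal the canonical functor).
[cite: MochizukiAbsTopIII2015, Cor 3.7 (i) p.87] -/
theorem pathFunctor_eq_of_obs {a : refCoreShape.{u}.Vertex} (p q : Path a refCoreShape.{u}.obs) :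
    𝔖.refDiagram.pathFunctor p = 𝔖.refDiagram.pathFunctor q :=
  (𝔖.pathFunctor_comp_toRef p).trans (𝔖.pathFunctor_comp_toRef q).symm

/-- No path leaves the core vertex of `𝒟‡_{≤1}` (an observable shape has no edges out of `v_𝒮`).
[cite: MochizukiAbsTopIII2015, Def 3.5 (iii) p.75] -/
theorem eq_obs_of_path {d : refCoreShape.{u}.Vertex} (r : Path refCoreShape.{u}.obs d) :
    d = refCoreShape.{u}.obs := by
  induction r with
  | nil => rfl
  | cons r e ih =>
    subst ih
    rename_i c
    cases c with
    | obs => rfl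
    | base b => exact PEmpty.elim e

/-- Whiskering an `eqToHom` between EQUAL functors and conjugating by `eqToHom`s gives the `eqToHom`
(used for the whiskering axiom of a family of identity homotopies). [folklore] -/
private theorem eqToHom_whisker_conj {C₀ C₁ C₂ C₃ : Type u} [Category.{u} C₀] [Category.{u} C₁]
    [Category.{u} C₂] [Category.{u} C₃] {R₁ : C₀ ⥤ C₁} {P Q : C₁ ⥤ C₂} {R₂ : C₂ ⥤ C₃}
    {S T : C₀ ⥤ C₃} (hPQ : P = Q) (hS : S = R₁ ⋙ P ⋙ R₂) (hT : R₁ ⋙ Q ⋙ R₂ = T) (hST : S = T) :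
    eqToHom hST = eqToHom hS ≫
      Functor.whiskerLeft R₁ (Functor.whiskerRight (eqToHom hPQ) R₂) ≫ eqToHom hT := by
  subst hS; subst hT; subst hPQ
  simp

/-- The natural core structure on `𝒟‡_{≤1}`: boundary set = ALL co-verticial pairs of paths ending at
the core vertex, every homotopy the identity (`eqToHom` of `pathFunctor_eq_of_obs`).
[cite: MochizukiAbsTopIII2015, Cor 3.7 (i) p.87] -/
def refCoreFamily : 𝔖.refDiagram.HomotopyFamily where
  E := fun ⦃_ b⦄ _ _ => b = refCoreShape.{u}.obs
  isSaturated :=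
    { refl_left := fun _ _ _ _ h => h
      refl_right := fun _ _ _ _ h => h
      trans := fun _ _ _ _ _ h _ => h
      precomp := fun _ _ _ _ _ h _ => h
      postcomp := fun _ _ _ _ _ h r => by subst h; exact eq_obs_of_path r }
  η := fun ⦃_ _⦄ ⦃p q⦄ h => eqToHom (by subst h; exact 𝔖.pathFunctor_eq_of_obs p q)
  η_refl _ _ _ _ := eqToHom_refl _ _
  η_trans _ _ _ _ _ _ _ := (eqToHom_trans _ _).symm
  η_whisker _ _ _ _ _ _ _ _ _ := eqToHom_whisker_conj _ _ _ _

/-- The boundary paths of the natural core structure end at the core vertex (by definition).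
[cite: MochizukiAbsTopIII2015, Cor 3.7 (i) p.87] -/
theorem refCoreFamily_terminal ⦃a b : refCoreShape.{u}.Vertex⦄ ⦃p q : Path a b⦄
    (h : 𝔖.refCoreFamily.E p q) : b = refCoreShape.{u}.obs := h

/-- The observable `(𝒟‡_{≤1}, 𝒳, identity family)` is a core: its boundary set is all co-verticial
pairs into the core vertex, and every vertex `⋎` reaches the core vertex via `π_⋎`.
[cite: MochizukiAbsTopIII2015, Cor 3.7 (i) p.87] -/
theorem refCoreObs_isCore : (𝔖.refCoreObs 𝔖.refCoreFamily 𝔖.refCoreFamily_terminal).IsCore where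
  boundary_all _ _ _ := rfl
  reaches_obs a := by
    obtain ⟨a, ha⟩ := a
    cases a with
    | first n => exact ⟨(Path.nil : Path (refCoreShape.{u}.base ⟨.first n, ha⟩) _).cons PUnit.unit⟩
    | box => exact False.elim (by simpa [Cor37Vertex.row] using ha.2)
    | space => exact False.elim (by simpa [Cor37Vertex.row] using ha.2)
    | galois => exact False.elim (by simpa [Cor37Vertex.row] using ha.2)
    | ref => exact False.elim (ha.1 rfl)

/-- **Cor 3.7 (i), second half, DISCHARGED** for every setting: "the 'second factor' `𝒳` 'forms a
core' of the functors in `𝒟‡_{≤1}`". [cite: MochizukiAbsTopIII2015, Cor 3.7 (i) p.87] -/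
theorem refCoreStmt_holds : 𝔖.RefCoreStmt :=
  ⟨𝔖.refCoreFamily, 𝔖.refCoreFamily_terminal, 𝔖.refCoreObs_isCore⟩

/-- Hence Cor 3.7 (i) reduces to its first half (`𝔈` forms a core of `𝒟†`).
[cite: MochizukiAbsTopIII2015, Cor 3.7 (i) p.87] -/
theorem cor_3_7_i_iff : 𝔖.Cor_3_7_i ↔ 𝔖.GaloisCoreStmt :=
  ⟨fun h => h.1, fun h => ⟨h, 𝔖.refCoreStmt_holds⟩⟩

end BiAnabelianSetting

end Literature.AnabelianGeometry.AbsoluteAnabelian.AbsTopIII
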